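import Summits.AtomisticToContinuum.HydrodynamicLimit.Theorems.ImplosionDichotomyHydroLimitInBandWindowBalance
import Summits.AtomisticToContinuum.HydrodynamicLimit.Theorems.AntiMazurCoboundariesCellForecastPressureDecayKBClosureEntropyTools

/-!
# The one-window ENTROPY INEQUALITY along the entropy clock (crux `HydroLimitInBand`, stmt-9133, line `IdeatorOneSketch`)

Support file (`--supports stmt-AtomisticToContinuum-9133`) for the heart `stub_windowEntropyIncrementInBand` of the
registered skeleton v6 of line `IdeatorOneSketch` (crux
`Summit.AtomisticToContinuum.HydrodynamicLimit.Theses.ImplosionDichotomy.HydroLimitInBand`). Yau's relative-entropy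
method over ONE window `[s, s + h]` of the hard-sphere system on `𝕋³` started from the local Gibbs law
`λ_N = localGibbsLaw σ a₀ u₀ θ₀ N Φ`, with a smooth reference `ψ = (b, w, ϑ)` on the window and a continuous
reference `ψ′ = (b′, w′, ϑ′)` from `s + h` on (`f_r := lawAt Φ λ_N r`):

* §1 `lawAt_add_localGibbsLaw`, `integral_lawAt_add` — the flow property in law: `f_{s+h} = (Φ_h)_* f_s`, so
  `E_{f_{s+h}}[F] = E_{f_s}[F ∘ Φ_h]`.
* §2 `integral_le_inv_mul_toReal_klDiv_add` — the ENTROPY INEQUALITY with a tilt `γ > 0` against an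
  exponential-moment bound in `lintegral` form: `KL(μ‖ν) < ∞`, `Y ∈ L¹(μ)`, `∫⁻ e^{γY} dν ≤ e^B` ⟹
  `E_μ Y ≤ γ⁻¹ (KL(μ‖ν) + B)` (from the tree's log form `EntropyBall.integral_le_toReal_klDiv_add_log`).
* §3 `toReal_klDiv_window_sub_eq_integral` — the window increment as ONE expectation under `f_s`:
  `KL(f_{s+h} ‖ ψ′_N) − KL(f_s ‖ ψ_N) = E_{f_s}[Ỹ]`,
  `Ỹ(z) = −(∫₀ʰ G′_ψ(Φ_r z) dr + W^mom(z,h) + W^en(z,h)) + (G_ψ − G_{ψ′})(Φ_h z) + (log Z_pos(b′) − log Z_pos(b))`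
  (the landed identity `windowEntropyBalance_identity`, R1, with its switch term transported to `f_s`), together
  with the `f_s`-integrability of `Ỹ`. (Finiteness `KL(f_s ‖ ψ_N) < ∞` is the tree's
  `JaynesSqueezeClosure.klDiv_lawAt_localGibbsLaw_ne_top`; §4 takes it as a hypothesis to keep the imports of this file
  within those of R1.)
* §4 `toReal_klDiv_window_sub_le` — THE WINDOW ENTROPY INEQUALITY: for every `γ > 0`, every measurable
  `Y ∈ L¹(f_s)` ("the good part", chosen by the consumer) with `∫⁻ e^{γY} dψ_N ≤ e^B`,
  `KL(f_{s+h} ‖ ψ′_N) − KL(f_s ‖ ψ_N) ≤ γ⁻¹ KL(f_s ‖ ψ_N) + γ⁻¹ B + E_{f_s}[Ỹ − Y]`.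
  With `γ = β/h` this is the full-window step of the clock, REDUCED to an exponential-moment bound under the
  LOCAL GIBBS law `ψ_N` over one window (the format of the line's window-LD inputs) plus an `L¹(f_s)` remainder.

References: H.-T. Yau, Lett. Math. Phys. 22 (1991) 63–80, §2; C. Kipnis, C. Landim, *Scaling Limits of
Interacting Particle Systems* (1999), App. 1 §8; S. Olla, S. R. S. Varadhan, H.-T. Yau, Comm. Math. Phys. 155 (1993) §3.
prover-line-stmt-AtomisticToContinuum-9133-c1-0 (lead, cycle 2).
-/

noncomputable section

open MeasureTheory Filter Set Topology InformationTheory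
open scoped ENNReal InnerProductSpace

namespace Summit.AtomisticToContinuum.HydrodynamicLimit.Theorems.EntropyClockDock

open Literature.MathematicalPhysics.KineticTheory Literature.Analysis.FluidPDE
open Literature.Analysis.FunctionSpaces

variable {σ : ℝ} {a₀ θ₀ : T3 → ℝ} {u₀ : T3 → V3}

/-! ### §1 The flow property in law -/

/-- **`f_{s+h} = (Φ_h)_* f_s`**: the law at time `s + h` is the push-forward by `Φ_h` of the law at time `s`
(group law `Φ.flow_add` on the good set, which carries the local Gibbs law). [folklore] -/
theorem lawAt_add_localGibbsLaw (σ : ℝ) (a₀ θ₀ : T3 → ℝ) (u₀ : T3 → V3) (N : ℕ)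
    (Φ : HardSphereFlow (Torus.geometry (Fin 3)) (hsDiameter σ N) (N + 1)) (s h : ℝ) :
    Φ.lawAt (localGibbsLaw σ a₀ u₀ θ₀ N Φ) (s + h) =
      (Φ.lawAt (localGibbsLaw σ a₀ u₀ θ₀ N Φ) s).map (Φ.flow h) := by
  rw [HardSphereFlow.lawAt_eq, HardSphereFlow.lawAt_eq,
    Measure.map_map (Φ.measurable_flow h) (Φ.measurable_flow s)]
  refine Measure.map_congr ?_
  filter_upwards [ae_mem_good_localGibbsLaw σ a₀ θ₀ u₀ N Φ] with z hz
  rw [Function.comp_apply, add_comm s h, Φ.flow_add h s z hz]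

/-- **Transport of expectations over one window**: `E_{f_{s+h}}[F] = E_{f_s}[F ∘ Φ_h]`. [folklore] -/
theorem integral_lawAt_add (σ : ℝ) (a₀ θ₀ : T3 → ℝ) (u₀ : T3 → V3) (N : ℕ)
    (Φ : HardSphereFlow (Torus.geometry (Fin 3)) (hsDiameter σ N) (N + 1)) (s h : ℝ)
    {F : Config (N + 1) (Fin 3) T3 → ℝ} (hF : Measurable F) :
    ∫ z, F z ∂(Φ.lawAt (localGibbsLaw σ a₀ u₀ θ₀ N Φ) (s + h)) =
      ∫ z, F (Φ.flow h z) ∂(Φ.lawAt (localGibbsLaw σ a₀ u₀ θ₀ N Φ) s) := by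
  rw [lawAt_add_localGibbsLaw]
  exact integral_map (Φ.measurable_flow h).aemeasurable hF.aestronglyMeasurable

/-- The law at time `s` gives full mass to the good set. [folklore] -/
theorem ae_mem_good_lawAt (σ : ℝ) (a₀ θ₀ : T3 → ℝ) (u₀ : T3 → V3) (N : ℕ)
    (Φ : HardSphereFlow (Torus.geometry (Fin 3)) (hsDiameter σ N) (N + 1)) (s : ℝ) :
    ∀ᵐ y ∂(Φ.lawAt (localGibbsLaw σ a₀ u₀ θ₀ N Φ) s), y ∈ Φ.good := by
  rw [HardSphereFlow.lawAt_eq]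
  exact (ae_map_iff (Φ.measurable_flow s).aemeasurable Φ.measurableSet_good).2
    ((ae_mem_good_localGibbsLaw σ a₀ θ₀ u₀ N Φ).mono fun z hz => Φ.mapsTo_good s hz)

/-! ### §2 The entropy inequality with a tilt, against an exponential-moment bound -/

section EntropyInequality

variable {α : Type*} [MeasurableSpace α] {μ ν : Measure α} [IsProbabilityMeasure μ] [IsProbabilityMeasure ν]

/-- **Entropy inequality with a tilt `γ > 0` against an exponential-moment bound in `lintegral` form**: for probability
measures `μ, ν` with `KL(μ‖ν) < ∞`, a measurable `Y ∈ L¹(μ)` and `∫⁻ e^{γY} dν ≤ e^B`: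
`E_μ Y ≤ γ⁻¹ (KL(μ‖ν) + B)`. [cite: KipnisLandim1999, Appendix 1 §8] -/
theorem integral_le_inv_mul_toReal_klDiv_add (hfin : klDiv μ ν ≠ ∞) {Y : α → ℝ} (hYm : Measurable Y)
    (hY : Integrable Y μ) {γ : ℝ} (hγ : 0 < γ) {B : ℝ}
    (hB : ∫⁻ x, ENNReal.ofReal (Real.exp (γ * Y x)) ∂ν ≤ ENNReal.ofReal (Real.exp B)) :
    ∫ x, Y x ∂μ ≤ γ⁻¹ * ((klDiv μ ν).toReal + B) := by
  -- `e^{γY}` is `ν`-integrable: measurable, nonnegative, finite `lintegral`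
  have hmeas : AEStronglyMeasurable (fun x => Real.exp (γ * Y x)) ν :=
    (hYm.const_mul γ).exp.aestronglyMeasurable
  have hexp : Integrable (fun x => Real.exp (γ * Y x)) ν := by
    refine ⟨hmeas, ?_⟩
    rw [hasFiniteIntegral_iff_ofReal (ae_of_all _ fun x => (Real.exp_pos _).le)]
    exact hB.trans_lt ENNReal.ofReal_lt_top
  have hpos : 0 < ∫ x, Real.exp (γ * Y x) ∂ν := integral_exp_pos hexp
  have hle : ∫ x, Real.exp (γ * Y x) ∂ν ≤ Real.exp B := by
    rw [← ENNReal.ofReal_le_ofReal_iff (Real.exp_pos B).le,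
      ofReal_integral_eq_lintegral_ofReal hexp (ae_of_all _ fun x => (Real.exp_pos _).le)]
    exact hB
  have hlog : Real.log (∫ x, Real.exp (γ * Y x) ∂ν) ≤ B := by
    rw [← Real.log_exp B]
    exact Real.log_le_log hpos hle
  have h := EntropyBall.integral_le_toReal_klDiv_add_log hfin (hY.const_mul γ) hexp
  rw [integral_const_mul] at h
  rw [le_inv_mul_iff₀ hγ]
  linarith

end EntropyInequality

/-! ### §3 The window increment as one expectation under `f_s` -/

/-- **The window functional is `f_s`-integrable and the increment is its expectation.** For `0 < σ ≤ 1/2`,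
continuous positive initial profiles, a SMOOTH positive reference `ψ = (b, w, ϑ)`, a continuous positive reference
`ψ′ = (b′, w′, ϑ′)`, `s, h ≥ 0`: with
`Ỹ(z) := −(∫₀ʰ G′_ψ(Φ_r z) dr + W^mom_{w/ϑ}(z,h) + W^en_{−1/ϑ}(z,h)) + (G_ψ − G_{ψ′})(Φ_h z) + (log Z_pos(b′) − log Z_pos(b))`,
`Ỹ ∈ L¹(f_s)` and `KL(f_{s+h} ‖ ψ′_N) − KL(f_s ‖ ψ_N) = E_{f_s}[Ỹ]` (R1 `windowEntropyBalance_identity` + §1).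
[cite: Yau1991, §2] -/
theorem toReal_klDiv_window_sub_eq_integral (hσ : 0 < σ) (hσ2 : σ ≤ 1 / 2) (ha : Continuous a₀)
    (hθ : Continuous θ₀) (hu : Continuous u₀) (ha0 : ∀ x, 0 < a₀ x) (hθ0 : ∀ x, 0 < θ₀ x)
    {b ϑ : T3 → ℝ} {w : T3 → V3} (hbs : Torus.IsSmooth b) (hϑs : Torus.IsSmooth ϑ) (hws : Torus.IsSmooth w)
    (hb0 : ∀ x, 0 < b x) (hϑ0 : ∀ x, 0 < ϑ x)
    {b' ϑ' : T3 → ℝ} {w' : T3 → V3} (hb' : Continuous b') (hϑ' : Continuous ϑ') (hw' : Continuous w')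
    (hb'0 : ∀ x, 0 < b' x) (hϑ'0 : ∀ x, 0 < ϑ' x)
    (N : ℕ) (Φ : HardSphereFlow (Torus.geometry (Fin 3)) (hsDiameter σ N) (N + 1)) {s h : ℝ} (hs : 0 ≤ s)
    (hh : 0 ≤ h) :
    Integrable (fun z : Config (N + 1) (Fin 3) T3 =>
        -((∫ r in (0 : ℝ)..h,
              ((∑ i, Torus.fderiv
                  (fun x => Real.log (b x) - 3 / 2 * Real.log (2 * Real.pi * ϑ x) - ‖w x‖ ^ 2 / (2 * ϑ x))
                  ((Φ.flow r z i).1) ((Φ.flow r z i).2)) +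
                momentumStreaming (fun x => (ϑ x)⁻¹ • w x) (Φ.flow r z) +
                energyStreaming (fun x => -(ϑ x)⁻¹) (Φ.flow r z))) +
            Φ.momentumTransfer (fun x => (ϑ x)⁻¹ • w x) z h +
            Φ.energyTransfer (fun x => -(ϑ x)⁻¹) z h) +
          ((∑ i, (Real.log (b (Φ.flow h z i).1) - 3 / 2 * Real.log (2 * Real.pi * ϑ (Φ.flow h z i).1) -
              ‖(Φ.flow h z i).2 - w (Φ.flow h z i).1‖ ^ 2 / (2 * ϑ (Φ.flow h z i).1))) -
            ∑ i, (Real.log (b' (Φ.flow h z i).1) - 3 / 2 * Real.log (2 * Real.pi * ϑ' (Φ.flow h z i).1) -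
              ‖(Φ.flow h z i).2 - w' (Φ.flow h z i).1‖ ^ 2 / (2 * ϑ' (Φ.flow h z i).1))) +
          (Real.log (posPartition b' (hsDiameter σ N) (N + 1)) - Real.log (posPartition b (hsDiameter σ N) (N + 1))))
      (Φ.lawAt (localGibbsLaw σ a₀ u₀ θ₀ N Φ) s) ∧
    (klDiv (Φ.lawAt (localGibbsLaw σ a₀ u₀ θ₀ N Φ) (s + h)) (localGibbsLaw σ b' w' ϑ' N Φ)).toReal -
        (klDiv (Φ.lawAt (localGibbsLaw σ a₀ u₀ θ₀ N Φ) s) (localGibbsLaw σ b w ϑ N Φ)).toReal =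
      ∫ z, (-((∫ r in (0 : ℝ)..h,
              ((∑ i, Torus.fderiv
                  (fun x => Real.log (b x) - 3 / 2 * Real.log (2 * Real.pi * ϑ x) - ‖w x‖ ^ 2 / (2 * ϑ x))
                  ((Φ.flow r z i).1) ((Φ.flow r z i).2)) +
                momentumStreaming (fun x => (ϑ x)⁻¹ • w x) (Φ.flow r z) +
                energyStreaming (fun x => -(ϑ x)⁻¹) (Φ.flow r z))) +
            Φ.momentumTransfer (fun x => (ϑ x)⁻¹ • w x) z h +
            Φ.energyTransfer (fun x => -(ϑ x)⁻¹) z h) +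
          ((∑ i, (Real.log (b (Φ.flow h z i).1) - 3 / 2 * Real.log (2 * Real.pi * ϑ (Φ.flow h z i).1) -
              ‖(Φ.flow h z i).2 - w (Φ.flow h z i).1‖ ^ 2 / (2 * ϑ (Φ.flow h z i).1))) -
            ∑ i, (Real.log (b' (Φ.flow h z i).1) - 3 / 2 * Real.log (2 * Real.pi * ϑ' (Φ.flow h z i).1) -
              ‖(Φ.flow h z i).2 - w' (Φ.flow h z i).1‖ ^ 2 / (2 * ϑ' (Φ.flow h z i).1))) +
          (Real.log (posPartition b' (hsDiameter σ N) (N + 1)) - Real.log (posPartition b (hsDiameter σ N) (N + 1))))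
        ∂(Φ.lawAt (localGibbsLaw σ a₀ u₀ θ₀ N Φ) s) := by
  obtain ⟨hb, hϑ, hw⟩ : Continuous b ∧ Continuous ϑ ∧ Continuous w :=
    ⟨hbs.continuous, hϑs.continuous, hws.continuous⟩
  set lam := localGibbsLaw σ a₀ u₀ θ₀ N Φ with hlam
  haveI : IsProbabilityMeasure lam := isProbabilityMeasure_localGibbsLaw ha hθ hu ha0 hθ0 hσ2 N Φ
  haveI : IsProbabilityMeasure (Φ.lawAt lam s) := by
    rw [HardSphereFlow.lawAt_eq]; exact Measure.isProbabilityMeasure_map (Φ.measurable_flow s).aemeasurable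
  have hgood := ae_mem_good_localGibbsLaw σ a₀ θ₀ u₀ N Φ
  have hgood' := ae_mem_good_lawAt σ a₀ θ₀ u₀ N Φ s
  -- names for the three pieces
  set P : Config (N + 1) (Fin 3) T3 → ℝ := fun z =>
    (∫ r in (0 : ℝ)..h,
        ((∑ i, Torus.fderiv
            (fun x => Real.log (b x) - 3 / 2 * Real.log (2 * Real.pi * ϑ x) - ‖w x‖ ^ 2 / (2 * ϑ x))
            ((Φ.flow r z i).1) ((Φ.flow r z i).2)) +
          momentumStreaming (fun x => (ϑ x)⁻¹ • w x) (Φ.flow r z) +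
          energyStreaming (fun x => -(ϑ x)⁻¹) (Φ.flow r z))) +
      Φ.momentumTransfer (fun x => (ϑ x)⁻¹ • w x) z h +
      Φ.energyTransfer (fun x => -(ϑ x)⁻¹) z h with hP
  set G : Config (N + 1) (Fin 3) T3 → ℝ := fun z =>
    ∑ i, (Real.log (b (z i).1) - 3 / 2 * Real.log (2 * Real.pi * ϑ (z i).1) -
      ‖(z i).2 - w (z i).1‖ ^ 2 / (2 * ϑ (z i).1)) with hG
  set G' : Config (N + 1) (Fin 3) T3 → ℝ := fun z =>
    ∑ i, (Real.log (b' (z i).1) - 3 / 2 * Real.log (2 * Real.pi * ϑ' (z i).1) -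
      ‖(z i).2 - w' (z i).1‖ ^ 2 / (2 * ϑ' (z i).1)) with hG'
  set c : ℝ := Real.log (posPartition b' (hsDiameter σ N) (N + 1)) -
    Real.log (posPartition b (hsDiameter σ N) (N + 1)) with hc
  have hGm : Measurable G := measurable_oneBodySum hb hϑ hw
  have hG'm : Measurable G' := measurable_oneBodySum hb' hϑ' hw'
  -- integrability of the switch term `(G − G′) ∘ Φ_h` under `f_s` (transport to `λ_N`, times `s + h`)
  have hQ : Integrable (fun z => G (Φ.flow h z) - G' (Φ.flow h z)) (Φ.lawAt lam s) := by
    rw [HardSphereFlow.lawAt_eq]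
    refine (integrable_map_measure ?_ (Φ.measurable_flow s).aemeasurable).2 ?_
    · exact ((hGm.comp (Φ.measurable_flow h)).sub (hG'm.comp (Φ.measurable_flow h))).aestronglyMeasurable
    · have h1 := integrable_oneBodySum_flow hσ2 ha hθ hu ha0 hθ0 hb hϑ hw hb0 hϑ0 N Φ (s + h)
      have h2 := integrable_oneBodySum_flow hσ2 ha hθ hu ha0 hθ0 hb' hϑ' hw' hb'0 hϑ'0 N Φ (s + h)
      refine (h1.sub h2).congr ?_
      filter_upwards [hgood] with z hz
      simp only [Pi.sub_apply, Function.comp_apply, hG, hG']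
      rw [add_comm s h, Φ.flow_add h s z hz]
  -- integrability of the window term `P` under `f_s`: pathwise it is `G ∘ Φ_h − G` on the good set
  have hPae : (fun y => G (Φ.flow h y) - G y) =ᵐ[Φ.lawAt lam s] P := by
    filter_upwards [hgood'] with y hy
    simp only [hP, hG]
    exact oneBodySum_flow_sub_eq Φ hbs hϑs hws hb0 hϑ0 hy hh
  have hPi : Integrable P (Φ.lawAt lam s) := by
    refine Integrable.congr ?_ hPae
    rw [HardSphereFlow.lawAt_eq]
    refine (integrable_map_measure ?_ (Φ.measurable_flow s).aemeasurable).2 ?_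
    · exact ((hGm.comp (Φ.measurable_flow h)).sub hGm).aestronglyMeasurable
    · have h1 := integrable_oneBodySum_flow hσ2 ha hθ hu ha0 hθ0 hb hϑ hw hb0 hϑ0 N Φ (s + h)
      have h2 := integrable_oneBodySum_flow hσ2 ha hθ hu ha0 hθ0 hb hϑ hw hb0 hϑ0 N Φ s
      refine (h1.sub h2).congr ?_
      filter_upwards [hgood] with z hz
      simp only [Pi.sub_apply, Function.comp_apply, hG]
      rw [add_comm s h, Φ.flow_add h s z hz]
  have hY : Integrable (fun z => -P z + (G (Φ.flow h z) - G' (Φ.flow h z)) + c) (Φ.lawAt lam s) :=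
    (hPi.neg.add hQ).add (integrable_const c)
  refine ⟨hY, ?_⟩
  -- the landed identity R1, with the switch term transported to `f_s`
  have R1 := windowEntropyBalance_identity σ hσ hσ2 a₀ θ₀ u₀ ha hθ hu ha0 hθ0 b ϑ w hbs hϑs hws hb0 hϑ0
    b' ϑ' w' hb' hϑ' hw' hb'0 hϑ'0 N Φ s h hs hh
  have hsw : ∫ z, (G z - G' z) ∂(Φ.lawAt lam (s + h)) = ∫ z, (G (Φ.flow h z) - G' (Φ.flow h z)) ∂(Φ.lawAt lam s) :=
    integral_lawAt_add σ a₀ θ₀ u₀ N Φ s h (hGm.sub hG'm)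
  change (klDiv (Φ.lawAt lam (s + h)) (localGibbsLaw σ b' w' ϑ' N Φ)).toReal -
      (klDiv (Φ.lawAt lam s) (localGibbsLaw σ b w ϑ N Φ)).toReal =
      -(∫ z, P z ∂(Φ.lawAt lam s)) + (∫ z, (G z - G' z) ∂(Φ.lawAt lam (s + h))) + c at R1
  have hPn : Integrable (fun z => -P z) (Φ.lawAt lam s) := hPi.neg
  have hY' : Integrable (fun z => -P z + (G (Φ.flow h z) - G' (Φ.flow h z))) (Φ.lawAt lam s) := hPn.add hQ
  have key : -(∫ z, P z ∂(Φ.lawAt lam s)) + (∫ z, (G (Φ.flow h z) - G' (Φ.flow h z)) ∂(Φ.lawAt lam s)) + c =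
      ∫ z, (-P z + (G (Φ.flow h z) - G' (Φ.flow h z)) + c) ∂(Φ.lawAt lam s) := by
    rw [integral_add hY' (integrable_const c), integral_add hPn hQ, integral_neg, integral_const, probReal_univ,
      one_smul]
  rw [R1, hsw, key]

/-! ### §4 The window entropy inequality -/

/-- **THE WINDOW ENTROPY INEQUALITY (Yau's step, reduced to a local-Gibbs exponential moment).** In the setting
of `toReal_klDiv_window_sub_eq_integral`, for every tilt `γ > 0`, every measurable `Y ∈ L¹(f_s)` (the "good part" of
the window functional `Ỹ`, chosen by the consumer) whose exponential moment under the window's LOCAL GIBBS reference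
`ψ_N = localGibbsLaw σ b w ϑ N Φ` obeys `∫⁻ e^{γY} dψ_N ≤ e^B`, and provided `KL(f_s ‖ ψ_N) < ∞` (always true for continuous
positive profiles: `JaynesSqueezeClosure.klDiv_lawAt_localGibbsLaw_ne_top`, Theorems/JaynesSqueezeBlockGibbsToRelEntropyLedger.lean):
`KL(f_{s+h} ‖ ψ′_N) − KL(f_s ‖ ψ_N) ≤ γ⁻¹ (KL(f_s ‖ ψ_N) + B) + E_{f_s}[Ỹ − Y]`.
(`γ = β/h`: full-window step of the entropy clock with rate `A = 1/β`; the remainder `E_{f_s}[Ỹ − Y]` is where velocity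
tails and clamp remainders are priced in `L¹` of the TRUE law.) [cite: Yau1991, §2] -/
theorem toReal_klDiv_window_sub_le (hσ : 0 < σ) (hσ2 : σ ≤ 1 / 2) (ha : Continuous a₀)
    (hθ : Continuous θ₀) (hu : Continuous u₀) (ha0 : ∀ x, 0 < a₀ x) (hθ0 : ∀ x, 0 < θ₀ x)
    {b ϑ : T3 → ℝ} {w : T3 → V3} (hbs : Torus.IsSmooth b) (hϑs : Torus.IsSmooth ϑ) (hws : Torus.IsSmooth w)
    (hb0 : ∀ x, 0 < b x) (hϑ0 : ∀ x, 0 < ϑ x)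
    {b' ϑ' : T3 → ℝ} {w' : T3 → V3} (hb' : Continuous b') (hϑ' : Continuous ϑ') (hw' : Continuous w')
    (hb'0 : ∀ x, 0 < b' x) (hϑ'0 : ∀ x, 0 < ϑ' x)
    (N : ℕ) (Φ : HardSphereFlow (Torus.geometry (Fin 3)) (hsDiameter σ N) (N + 1)) {s h : ℝ} (hs : 0 ≤ s)
    (hh : 0 ≤ h)
    (hfin : klDiv (Φ.lawAt (localGibbsLaw σ a₀ u₀ θ₀ N Φ) s) (localGibbsLaw σ b w ϑ N Φ) ≠ ⊤)
    {γ : ℝ} (hγ : 0 < γ) {Y : Config (N + 1) (Fin 3) T3 → ℝ} (hYm : Measurable Y)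
    (hYi : Integrable Y (Φ.lawAt (localGibbsLaw σ a₀ u₀ θ₀ N Φ) s)) {B : ℝ}
    (hB : ∫⁻ z, ENNReal.ofReal (Real.exp (γ * Y z)) ∂(localGibbsLaw σ b w ϑ N Φ) ≤ ENNReal.ofReal (Real.exp B)) :
    (klDiv (Φ.lawAt (localGibbsLaw σ a₀ u₀ θ₀ N Φ) (s + h)) (localGibbsLaw σ b' w' ϑ' N Φ)).toReal -
        (klDiv (Φ.lawAt (localGibbsLaw σ a₀ u₀ θ₀ N Φ) s) (localGibbsLaw σ b w ϑ N Φ)).toReal ≤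
      γ⁻¹ * ((klDiv (Φ.lawAt (localGibbsLaw σ a₀ u₀ θ₀ N Φ) s) (localGibbsLaw σ b w ϑ N Φ)).toReal + B) +
      ∫ z, (-((∫ r in (0 : ℝ)..h,
              ((∑ i, Torus.fderiv
                  (fun x => Real.log (b x) - 3 / 2 * Real.log (2 * Real.pi * ϑ x) - ‖w x‖ ^ 2 / (2 * ϑ x))
                  ((Φ.flow r z i).1) ((Φ.flow r z i).2)) +
                momentumStreaming (fun x => (ϑ x)⁻¹ • w x) (Φ.flow r z) +
                energyStreaming (fun x => -(ϑ x)⁻¹) (Φ.flow r z))) +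
            Φ.momentumTransfer (fun x => (ϑ x)⁻¹ • w x) z h +
            Φ.energyTransfer (fun x => -(ϑ x)⁻¹) z h) +
          ((∑ i, (Real.log (b (Φ.flow h z i).1) - 3 / 2 * Real.log (2 * Real.pi * ϑ (Φ.flow h z i).1) -
              ‖(Φ.flow h z i).2 - w (Φ.flow h z i).1‖ ^ 2 / (2 * ϑ (Φ.flow h z i).1))) -
            ∑ i, (Real.log (b' (Φ.flow h z i).1) - 3 / 2 * Real.log (2 * Real.pi * ϑ' (Φ.flow h z i).1) -
              ‖(Φ.flow h z i).2 - w' (Φ.flow h z i).1‖ ^ 2 / (2 * ϑ' (Φ.flow h z i).1))) +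
          (Real.log (posPartition b' (hsDiameter σ N) (N + 1)) - Real.log (posPartition b (hsDiameter σ N) (N + 1))) -
          Y z)
        ∂(Φ.lawAt (localGibbsLaw σ a₀ u₀ θ₀ N Φ) s) := by
  obtain ⟨hb, hϑ, hw⟩ : Continuous b ∧ Continuous ϑ ∧ Continuous w :=
    ⟨hbs.continuous, hϑs.continuous, hws.continuous⟩
  obtain ⟨hYt, hid⟩ := toReal_klDiv_window_sub_eq_integral hσ hσ2 ha hθ hu ha0 hθ0 hbs hϑs hws hb0 hϑ0
    hb' hϑ' hw' hb'0 hϑ'0 N Φ hs hh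
  haveI : IsProbabilityMeasure (localGibbsLaw σ b w ϑ N Φ) :=
    isProbabilityMeasure_localGibbsLaw hb hϑ hw hb0 hϑ0 hσ2 N Φ
  haveI : IsProbabilityMeasure (Φ.lawAt (localGibbsLaw σ a₀ u₀ θ₀ N Φ) s) := by
    haveI : IsProbabilityMeasure (localGibbsLaw σ a₀ u₀ θ₀ N Φ) :=
      isProbabilityMeasure_localGibbsLaw ha hθ hu ha0 hθ0 hσ2 N Φ
    rw [HardSphereFlow.lawAt_eq]; exact Measure.isProbabilityMeasure_map (Φ.measurable_flow s).aemeasurable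
  have hEI := integral_le_inv_mul_toReal_klDiv_add hfin hYm hYi hγ hB
  rw [hid, ← sub_add_cancel (∫ z, _ ∂(Φ.lawAt (localGibbsLaw σ a₀ u₀ θ₀ N Φ) s)) (∫ z, Y z ∂(Φ.lawAt (localGibbsLaw σ a₀ u₀ θ₀ N Φ) s)),
    ← integral_sub hYt hYi]
  linarith

end Summit.AtomisticToContinuum.HydrodynamicLimit.Theorems.EntropyClockDock

end
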